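import Mathlib
import HarnessLib
import Summits.Ventures.LatticeQCDFlow.Exactness.NCMCGeneralSpaceOverlap

/-!
# Bennett's optimal weight on a general state space: the Fermi function of the work minimises the two-sample variance

HONEST FRAMING: exact (Metropolis-corrected) sampling algorithms for lattice gauge theory;
figures of merit are autocorrelation/cost numbers at stated couplings and volumes; no
continuum-physics claim.

Venture `LatticeQCDFlow` (cell pub-lqcd), topic `Exactness`; FANOUT row 13 (`eng-snf`, GEN-11).
NEW WORK of the cell (general measure theory: a weighted Cauchy–Schwarz inequality on a probability
law through a completed square), not a published result; nothing is cited as a fact (C. H. Bennett,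
J. Comput. Phys. 22 (1976) 245, eqs. (6)–(12), named only).  General-state-space counterpart of the
two-law half of row 13's finite `Exactness/BennettOptimalWeight.lean` (`bennettVar_eq_of_crooks`,
`bennettVar_ge`, `bennettVar_bennettWeight`); setting of `NCMCGeneralSpaceOverlap.lean` /
`NCMCGeneralSpaceRelativeEntropy.lean`: a Crooks pair from `ν₀` to `ν₁` on a general measurable state
space, `P_F = fwdPathLaw ν₀ κF`, `P_R = fwdPathLaw ν₁ κR` with `dP_R/dP_F = e^{ΔF−W}`, `e^{−ΔF} = Z₁/Z₀`.

WHY.  `snf.estimators.bar` / `snf.twosided` report the acceptance-ratio estimate with Bennett's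
weight.  `NCMCGeneralSpaceBennettRoot.lean` says its population root is `ΔF`; THIS file says why that
weight and no other statistic of the evolution record: among all two-sample estimators
`mean_F(α e^{−W}) / mean_R(α)` of `e^{−ΔF}` the Fermi function of the work minimises the leading-order
variance, for EVERY protocol certified as a Crooks pair.

## Content (`nf, nr > 0` the two sample sizes, `g = e^{ΔF−W}/nf + 1/nr`, `G = E_{P_R}[1/g]`)

* `CrooksPair.integral_exp_neg_work_mul` — the two-sample identity `E_{P_F}[e^{−W} φ] = e^{−ΔF} E_{P_R}[φ]`
  for every `φ` (so every `α` gives a consistent ratio estimator).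
* **`CrooksPair.bennett_substitution`** — the variance functional
  `V(α) = (E_F[(α e^{−W})²]/E_F[α e^{−W}]² − 1)/nf + (E_R[α²]/E_R[α]² − 1)/nr` equals
  `E_R[g α²] / E_R[α]² − 1/nf − 1/nr`.
* `sq_integral_le_integral_mul_integral_inv` — weighted Cauchy–Schwarz on a probability law:
  `E[α]² ≤ E[g α²] · E[1/g]` for `g > 0` (completed square `E[g (α − c/g)²] ≥ 0`, `c = E[α]/E[1/g]`).
* **`CrooksPair.bennett_lower_bound`** — `1/G − 1/nf − 1/nr ≤ V(α)` for every measurable statistic `α`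
  of the record with `E_R[α] ≠ 0` and `g α² ∈ L¹(P_R)`;
  **`CrooksPair.bennett_bound_attained`** — equality for Bennett's weight
  `α⋆ = σ(log(nf/nr) + W − ΔF) = (1/nr)/g` (`bennettWeight_eq_inv_g`), the Fermi function of the
  shifted work: BAR is the minimum-variance member of the whole two-sample family on the engine's
  state space.

NOT formalised: the delta-method step from the estimator to the functional (the functional is the
object, as in Bennett's paper and in the finite file), the equality case (uniqueness up to a constant
factor `P_R`-a.s.), autocorrelation corrections.
-/

namespace Summit.Ventures.LatticeQCDFlow.Exactness.GeneralNCMC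

open MeasureTheory ProbabilityTheory Set Filter
open scoped ENNReal

variable {Ω E : Type*} [MeasurableSpace Ω] [MeasurableSpace E]

/-! ## Weighted Cauchy–Schwarz on a probability law -/

/-- **`E[α]² ≤ E[g α²] · E[1/g]`** for a positive measurable `g` with `1/g` bounded and `g α²`, `α`
integrable (probability law `μ`): the completed square `0 ≤ E[g (α − c/g)²]` with `c = E[α]/E[1/g]`. -/
theorem sq_integral_le_integral_mul_integral_inv {μ : Measure E} [IsProbabilityMeasure μ]
    {g α : E → ℝ} (hgpos : ∀ ε, 0 < g ε) (hα : Integrable α μ)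
    (hgα2 : Integrable (fun ε => g ε * α ε ^ 2) μ) (hginv : Integrable (fun ε => (g ε)⁻¹) μ)
    (hG : 0 < ∫ ε, (g ε)⁻¹ ∂μ) :
    (∫ ε, α ε ∂μ) ^ 2 ≤ (∫ ε, g ε * α ε ^ 2 ∂μ) * ∫ ε, (g ε)⁻¹ ∂μ := by
  set A := ∫ ε, α ε ∂μ with hA
  set G := ∫ ε, (g ε)⁻¹ ∂μ with hGdef
  set c := A / G with hc
  -- expand the completed square
  have hexp : ∀ ε, g ε * (α ε - c * (g ε)⁻¹) ^ 2 =
      g ε * α ε ^ 2 - 2 * c * α ε + c ^ 2 * (g ε)⁻¹ := fun ε => by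
    have hg0 : g ε ≠ 0 := (hgpos ε).ne'
    field_simp
    ring
  have hI1 : Integrable (fun ε => g ε * α ε ^ 2 - 2 * c * α ε) μ := hgα2.sub (hα.const_mul _)
  have hI2 : Integrable (fun ε => c ^ 2 * (g ε)⁻¹) μ := hginv.const_mul _
  have hnn : 0 ≤ ∫ ε, g ε * (α ε - c * (g ε)⁻¹) ^ 2 ∂μ :=
    integral_nonneg fun ε => mul_nonneg (hgpos ε).le (sq_nonneg _)
  simp_rw [hexp] at hnn
  rw [integral_add hI1 hI2, integral_sub hgα2 (hα.const_mul _), integral_const_mul,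
    integral_const_mul] at hnn
  rw [← hA, ← hGdef] at hnn
  -- `0 ≤ X − 2cA + c²G` with `c = A/G`, i.e. `A²/G ≤ X`
  have hkey : A ^ 2 / G ≤ ∫ ε, g ε * α ε ^ 2 ∂μ := by
    have : 2 * c * A - c ^ 2 * G = A ^ 2 / G := by
      rw [hc]
      field_simp
      ring
    linarith
  rwa [div_le_iff₀ hG] at hkey

namespace CrooksPair

variable {ν₀ ν₁ : Measure Ω} {κF κR : Kernel Ω E} {s e : E → Ω} {W : E → ℝ}

/-! ## The two-sample identity -/

/-- **`E_{P_F}[e^{−W} φ] = e^{−ΔF} · E_{P_R}[φ]`** for every `φ` on records (`dP_R/dP_F = e^{ΔF−W}`):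
the population identity behind every two-sample acceptance-ratio estimator of `e^{−ΔF}`. -/
theorem integral_exp_neg_work_mul [IsFiniteMeasure ν₀] [IsFiniteMeasure ν₁] [IsMarkovKernel κR]
    (h0 : ν₀ univ ≠ 0) (h1 : ν₁ univ ≠ 0) (h : CrooksPair ν₀ ν₁ κF κR s e W) {ΔF : ℝ}
    (hΔF : Real.exp (-ΔF) = ((ν₀ univ)⁻¹ * ν₁ univ).toReal) (φ : E → ℝ) :
    ∫ ε, Real.exp (-W ε) * φ ε ∂(fwdPathLaw ν₀ κF) = Real.exp (-ΔF) * ∫ ε, φ ε ∂(fwdPathLaw ν₁ κR) := by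
  have hd : Measurable fun ε => ENNReal.ofReal (Real.exp (ΔF - W ε)) :=
    (Real.measurable_exp.comp (measurable_const.sub h.measurable_W)).ennreal_ofReal
  have hlt : ∀ᵐ ε ∂(fwdPathLaw ν₀ κF), ENNReal.ofReal (Real.exp (ΔF - W ε)) < ∞ :=
    Eventually.of_forall fun _ => ENNReal.ofReal_lt_top
  rw [h.revPathLaw_eq_withDensity h0 h1 hΔF, integral_withDensity_eq_integral_toReal_smul hd hlt,
    ← integral_const_mul]
  refine integral_congr_ae (Eventually.of_forall fun ε => ?_)
  simp only
  rw [ENNReal.toReal_ofReal (Real.exp_pos _).le, smul_eq_mul, ← mul_assoc, ← Real.exp_add,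
    show -ΔF + (ΔF - W ε) = -W ε by ring]

/-! ## Bennett's substitution -/

/-- **Bennett's substitution.**  For every statistic `α` of the record the two-sample variance
functional is `E_R[g α²] / E_R[α]² − 1/nf − 1/nr`, `g = e^{ΔF−W}/nf + 1/nr`
(`E_F[α e^{−W}] = e^{−ΔF} E_R[α]`, `E_F[(α e^{−W})²] = e^{−2ΔF} E_R[e^{ΔF−W} α²]`). -/
theorem bennett_substitution [IsFiniteMeasure ν₀] [IsFiniteMeasure ν₁] [IsMarkovKernel κF]
    [IsMarkovKernel κR] (h0 : ν₀ univ ≠ 0) (h1 : ν₁ univ ≠ 0) (h : CrooksPair ν₀ ν₁ κF κR s e W)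
    {ΔF : ℝ} (hΔF : Real.exp (-ΔF) = ((ν₀ univ)⁻¹ * ν₁ univ).toReal) {nf nr : ℝ} (hnf : 0 < nf)
    (hnr : 0 < nr) {α : E → ℝ} (hA : ∫ ε, α ε ∂(fwdPathLaw ν₁ κR) ≠ 0)
    (hα2 : Integrable (fun ε => α ε ^ 2) (fwdPathLaw ν₁ κR))
    (hα2w : Integrable (fun ε => Real.exp (ΔF - W ε) * α ε ^ 2) (fwdPathLaw ν₁ κR)) :
    ((∫ ε, (α ε * Real.exp (-W ε)) ^ 2 ∂(fwdPathLaw ν₀ κF)) /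
          (∫ ε, α ε * Real.exp (-W ε) ∂(fwdPathLaw ν₀ κF)) ^ 2 - 1) / nf +
        ((∫ ε, α ε ^ 2 ∂(fwdPathLaw ν₁ κR)) / (∫ ε, α ε ∂(fwdPathLaw ν₁ κR)) ^ 2 - 1) / nr =
      (∫ ε, (Real.exp (ΔF - W ε) / nf + 1 / nr) * α ε ^ 2 ∂(fwdPathLaw ν₁ κR)) /
          (∫ ε, α ε ∂(fwdPathLaw ν₁ κR)) ^ 2 - 1 / nf - 1 / nr := by
  set A := ∫ ε, α ε ∂(fwdPathLaw ν₁ κR) with hAdef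
  set B := ∫ ε, Real.exp (ΔF - W ε) * α ε ^ 2 ∂(fwdPathLaw ν₁ κR) with hBdef
  set C := ∫ ε, α ε ^ 2 ∂(fwdPathLaw ν₁ κR) with hCdef
  have hu : Real.exp (-ΔF) ≠ 0 := Real.exp_ne_zero _
  -- first moment on the forward side
  have h1m : ∫ ε, α ε * Real.exp (-W ε) ∂(fwdPathLaw ν₀ κF) = Real.exp (-ΔF) * A := by
    rw [hAdef, ← h.integral_exp_neg_work_mul h0 h1 hΔF α]
    exact integral_congr_ae (Eventually.of_forall fun ε => by simp only; ring)
  -- second moment on the forward side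
  have h2m : ∫ ε, (α ε * Real.exp (-W ε)) ^ 2 ∂(fwdPathLaw ν₀ κF) =
      Real.exp (-ΔF) * (Real.exp (-ΔF) * B) := by
    rw [hBdef, ← integral_const_mul (Real.exp (-ΔF)),
      ← h.integral_exp_neg_work_mul h0 h1 hΔF (fun ε => Real.exp (-ΔF) * (Real.exp (ΔF - W ε) * α ε ^ 2))]
    refine integral_congr_ae (Eventually.of_forall fun ε => ?_)
    simp only
    rw [show (α ε * Real.exp (-W ε)) ^ 2 = α ε ^ 2 * (Real.exp (-W ε) * Real.exp (-W ε)) by ring,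
      ← Real.exp_add, show Real.exp (-W ε) * (Real.exp (-ΔF) * (Real.exp (ΔF - W ε) * α ε ^ 2)) =
        α ε ^ 2 * (Real.exp (-W ε) * Real.exp (-ΔF) * Real.exp (ΔF - W ε)) by ring,
      ← Real.exp_add, ← Real.exp_add]
    congr 2
    ring
  -- the `g`-moment splits
  have hg : ∫ ε, (Real.exp (ΔF - W ε) / nf + 1 / nr) * α ε ^ 2 ∂(fwdPathLaw ν₁ κR) =
      B / nf + C / nr := by
    have hsplit : ∀ ε, (Real.exp (ΔF - W ε) / nf + 1 / nr) * α ε ^ 2 =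
        nf⁻¹ * (Real.exp (ΔF - W ε) * α ε ^ 2) + nr⁻¹ * α ε ^ 2 := fun ε => by
      field_simp
    simp_rw [hsplit]
    rw [integral_add (hα2w.const_mul _) (hα2.const_mul _), integral_const_mul, integral_const_mul,
      ← hBdef, ← hCdef]
    field_simp
  rw [h1m, h2m, hg]
  have hA2 : A ^ 2 ≠ 0 := pow_ne_zero 2 hA
  field_simp
  ring

/-! ## The lower bound and its attainment -/

omit [MeasurableSpace E] in
/-- Bennett's `g = e^{ΔF−W}/nf + 1/nr` is positive … -/
theorem bennett_g_pos' {nf nr : ℝ} (hnf : 0 < nf) (hnr : 0 < nr) (W : E → ℝ) (ΔF : ℝ) (ε : E) :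
    0 < Real.exp (ΔF - W ε) / nf + 1 / nr :=
  add_pos (div_pos (Real.exp_pos _) hnf) (div_pos one_pos hnr)

omit [MeasurableSpace E] in
/-- … and its inverse is bounded by `nr`. -/
theorem inv_bennett_g_le {nf nr : ℝ} (hnf : 0 < nf) (hnr : 0 < nr) (W : E → ℝ) (ΔF : ℝ) (ε : E) :
    (Real.exp (ΔF - W ε) / nf + 1 / nr)⁻¹ ≤ nr := by
  rw [inv_le_comm₀ (bennett_g_pos' hnf hnr W ΔF ε) hnr, one_div]
  exact le_add_of_nonneg_left (div_pos (Real.exp_pos _) hnf).le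

/-- The inverse `1/g` is `P_R`-integrable (bounded, measurable) … -/
theorem integrable_inv_bennett_g [IsFiniteMeasure ν₁] [IsMarkovKernel κR] (h1 : ν₁ univ ≠ 0)
    (h : CrooksPair ν₀ ν₁ κF κR s e W) {nf nr : ℝ} (hnf : 0 < nf) (hnr : 0 < nr) (ΔF : ℝ) :
    Integrable (fun ε => (Real.exp (ΔF - W ε) / nf + 1 / nr)⁻¹) (fwdPathLaw ν₁ κR) := by
  haveI := isProbabilityMeasure_fwdPathLaw ν₁ h1 κR
  have hm : Measurable fun ε => (Real.exp (ΔF - W ε) / nf + 1 / nr)⁻¹ :=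
    (((Real.measurable_exp.comp (measurable_const.sub h.measurable_W)).div_const _).add_const _).inv
  refine (integrable_const nr).mono' hm.aestronglyMeasurable (Eventually.of_forall fun ε => ?_)
  rw [Real.norm_eq_abs, abs_of_pos (inv_pos.2 (bennett_g_pos' hnf hnr W ΔF ε))]
  exact inv_bennett_g_le hnf hnr W ΔF ε

/-- … with positive mean `G = E_R[1/g] > 0` (Bennett's overlap integral). -/
theorem integral_inv_bennett_g_pos [IsFiniteMeasure ν₁] [IsMarkovKernel κR] (h1 : ν₁ univ ≠ 0)
    (h : CrooksPair ν₀ ν₁ κF κR s e W) {nf nr : ℝ} (hnf : 0 < nf) (hnr : 0 < nr) (ΔF : ℝ) :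
    0 < ∫ ε, (Real.exp (ΔF - W ε) / nf + 1 / nr)⁻¹ ∂(fwdPathLaw ν₁ κR) := by
  haveI := isProbabilityMeasure_fwdPathLaw ν₁ h1 κR
  rw [integral_pos_iff_support_of_nonneg (fun ε => (inv_pos.2 (bennett_g_pos' hnf hnr W ΔF ε)).le)
    (h.integrable_inv_bennett_g h1 hnf hnr ΔF)]
  have hsupp : Function.support (fun ε => (Real.exp (ΔF - W ε) / nf + 1 / nr)⁻¹) = univ := by
    ext ε
    simp only [Function.mem_support, mem_univ, iff_true]
    exact (inv_pos.2 (bennett_g_pos' hnf hnr W ΔF ε)).ne'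
  rw [hsupp, measure_univ]
  exact one_pos

/-- **Bennett's lower bound on a general state space.**  For every measurable statistic `α` of the
evolution record with `E_R[α] ≠ 0`, `α² ∈ L¹(P_R)` and `e^{ΔF−W} α² ∈ L¹(P_R)`:
`1/G − 1/nf − 1/nr ≤ V(α)`, `G = E_{P_R}[1/(e^{ΔF−W}/nf + 1/nr)]`. -/
theorem bennett_lower_bound [IsFiniteMeasure ν₀] [IsFiniteMeasure ν₁] [IsMarkovKernel κF]
    [IsMarkovKernel κR] (h0 : ν₀ univ ≠ 0) (h1 : ν₁ univ ≠ 0) (h : CrooksPair ν₀ ν₁ κF κR s e W)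
    {ΔF : ℝ} (hΔF : Real.exp (-ΔF) = ((ν₀ univ)⁻¹ * ν₁ univ).toReal) {nf nr : ℝ} (hnf : 0 < nf)
    (hnr : 0 < nr) {α : E → ℝ} (hαm : Measurable α) (hA : ∫ ε, α ε ∂(fwdPathLaw ν₁ κR) ≠ 0)
    (hα2 : Integrable (fun ε => α ε ^ 2) (fwdPathLaw ν₁ κR))
    (hα2w : Integrable (fun ε => Real.exp (ΔF - W ε) * α ε ^ 2) (fwdPathLaw ν₁ κR)) :
    1 / (∫ ε, (Real.exp (ΔF - W ε) / nf + 1 / nr)⁻¹ ∂(fwdPathLaw ν₁ κR)) - 1 / nf - 1 / nr ≤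
      ((∫ ε, (α ε * Real.exp (-W ε)) ^ 2 ∂(fwdPathLaw ν₀ κF)) /
            (∫ ε, α ε * Real.exp (-W ε) ∂(fwdPathLaw ν₀ κF)) ^ 2 - 1) / nf +
        ((∫ ε, α ε ^ 2 ∂(fwdPathLaw ν₁ κR)) / (∫ ε, α ε ∂(fwdPathLaw ν₁ κR)) ^ 2 - 1) / nr := by
  haveI := isProbabilityMeasure_fwdPathLaw ν₁ h1 κR
  rw [h.bennett_substitution h0 h1 hΔF hnf hnr hA hα2 hα2w]
  have hG := h.integral_inv_bennett_g_pos h1 hnf hnr ΔF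
  -- `α` is integrable (it is in `L²` of a probability law)
  have hαi : Integrable α (fwdPathLaw ν₁ κR) := by
    have hL2 : MemLp α 2 (fwdPathLaw ν₁ κR) :=
      (memLp_two_iff_integrable_sq hαm.aestronglyMeasurable).2 hα2
    exact hL2.integrable one_le_two
  have hgα2 : Integrable (fun ε => (Real.exp (ΔF - W ε) / nf + 1 / nr) * α ε ^ 2) (fwdPathLaw ν₁ κR) := by
    have hsplit : ∀ ε, (Real.exp (ΔF - W ε) / nf + 1 / nr) * α ε ^ 2 =
        nf⁻¹ * (Real.exp (ΔF - W ε) * α ε ^ 2) + nr⁻¹ * α ε ^ 2 := fun ε => by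
      field_simp
    simp_rw [hsplit]
    exact (hα2w.const_mul _).add (hα2.const_mul _)
  have hcs := sq_integral_le_integral_mul_integral_inv (μ := fwdPathLaw ν₁ κR)
    (bennett_g_pos' hnf hnr W ΔF) hαi hgα2 (h.integrable_inv_bennett_g h1 hnf hnr ΔF) hG
  have hA2 : 0 < (∫ ε, α ε ∂(fwdPathLaw ν₁ κR)) ^ 2 := by positivity
  have hle : 1 / (∫ ε, (Real.exp (ΔF - W ε) / nf + 1 / nr)⁻¹ ∂(fwdPathLaw ν₁ κR)) ≤
      (∫ ε, (Real.exp (ΔF - W ε) / nf + 1 / nr) * α ε ^ 2 ∂(fwdPathLaw ν₁ κR)) /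
        (∫ ε, α ε ∂(fwdPathLaw ν₁ κR)) ^ 2 := by
    rw [div_le_div_iff₀ hG hA2, one_mul]
    exact hcs
  linarith

omit [MeasurableSpace E] in
/-- **Bennett's weight is the Fermi function of the shifted work**:
`σ(log(nf/nr) + W − ΔF) = (1/nr) / (e^{ΔF−W}/nf + 1/nr)`, a constant over `g`. -/
theorem bennettWeight_eq_inv_g {nf nr : ℝ} (hnf : 0 < nf) (hnr : 0 < nr) (W : E → ℝ) (ΔF : ℝ)
    (ε : E) :
    Real.sigmoid (Real.log (nf / nr) + W ε - ΔF) = (1 / nr) / (Real.exp (ΔF - W ε) / nf + 1 / nr) := by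
  rw [Real.sigmoid_def]
  have hexp : Real.exp (-(Real.log (nf / nr) + W ε - ΔF)) = (nr / nf) * Real.exp (ΔF - W ε) := by
    rw [show -(Real.log (nf / nr) + W ε - ΔF) = -Real.log (nf / nr) + (ΔF - W ε) by ring,
      Real.exp_add, Real.exp_neg, Real.exp_log (div_pos hnf hnr), inv_div]
  rw [hexp]
  have hnf0 : nf ≠ 0 := hnf.ne'
  have hnr0 : nr ≠ 0 := hnr.ne'
  have hpos : 0 < Real.exp (ΔF - W ε) := Real.exp_pos _
  field_simp
  ring

/-- **The bound is attained by Bennett's weight.**  For `α⋆ = σ(log(nf/nr) + W − ΔF)`: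
`V(α⋆) = 1/G − 1/nf − 1/nr` — the acceptance-ratio estimator the engine reports is the
minimum-variance two-sample estimator, for every Crooks pair. -/
theorem bennett_bound_attained [IsFiniteMeasure ν₀] [IsFiniteMeasure ν₁] [IsMarkovKernel κF]
    [IsMarkovKernel κR] (h0 : ν₀ univ ≠ 0) (h1 : ν₁ univ ≠ 0) (h : CrooksPair ν₀ ν₁ κF κR s e W)
    {ΔF : ℝ} (hΔF : Real.exp (-ΔF) = ((ν₀ univ)⁻¹ * ν₁ univ).toReal) {nf nr : ℝ} (hnf : 0 < nf)
    (hnr : 0 < nr) :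
    ((∫ ε, (Real.sigmoid (Real.log (nf / nr) + W ε - ΔF) * Real.exp (-W ε)) ^ 2 ∂(fwdPathLaw ν₀ κF)) /
            (∫ ε, Real.sigmoid (Real.log (nf / nr) + W ε - ΔF) * Real.exp (-W ε) ∂(fwdPathLaw ν₀ κF)) ^ 2
          - 1) / nf +
        ((∫ ε, Real.sigmoid (Real.log (nf / nr) + W ε - ΔF) ^ 2 ∂(fwdPathLaw ν₁ κR)) /
            (∫ ε, Real.sigmoid (Real.log (nf / nr) + W ε - ΔF) ∂(fwdPathLaw ν₁ κR)) ^ 2 - 1) / nr =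
      1 / (∫ ε, (Real.exp (ΔF - W ε) / nf + 1 / nr)⁻¹ ∂(fwdPathLaw ν₁ κR)) - 1 / nf - 1 / nr := by
  haveI := isProbabilityMeasure_fwdPathLaw ν₁ h1 κR
  set g : E → ℝ := fun ε => Real.exp (ΔF - W ε) / nf + 1 / nr with hgdef
  have hgpos : ∀ ε, 0 < g ε := bennett_g_pos' hnf hnr W ΔF
  have hw : ∀ ε, Real.sigmoid (Real.log (nf / nr) + W ε - ΔF) = (1 / nr) * (g ε)⁻¹ := fun ε => by
    rw [bennettWeight_eq_inv_g hnf hnr W ΔF ε, div_eq_mul_inv]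
  have hGi : Integrable (fun ε => (g ε)⁻¹) (fwdPathLaw ν₁ κR) := h.integrable_inv_bennett_g h1 hnf hnr ΔF
  have hG : 0 < ∫ ε, (g ε)⁻¹ ∂(fwdPathLaw ν₁ κR) := h.integral_inv_bennett_g_pos h1 hnf hnr ΔF
  rw [show (∫ ε, (Real.exp (ΔF - W ε) / nf + 1 / nr)⁻¹ ∂(fwdPathLaw ν₁ κR)) =
    ∫ ε, (g ε)⁻¹ ∂(fwdPathLaw ν₁ κR) from rfl]
  simp_rw [hw]
  -- the three `P_R` moments of `α⋆ = (1/nr) g⁻¹`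
  have hA : ∫ ε, (1 / nr) * (g ε)⁻¹ ∂(fwdPathLaw ν₁ κR) = (1 / nr) * ∫ ε, (g ε)⁻¹ ∂(fwdPathLaw ν₁ κR) :=
    integral_const_mul _ _
  have hsq_form : ∀ ε, ((1 / nr) * (g ε)⁻¹) ^ 2 = (1 / nr) ^ 2 * (g ε)⁻¹ * (g ε)⁻¹ := fun ε => by ring
  -- integrability of the square terms (bounded by `nr · g⁻¹`)
  have hinv2 : Integrable (fun ε => (g ε)⁻¹ * (g ε)⁻¹) (fwdPathLaw ν₁ κR) := by
    refine (hGi.const_mul nr).mono' (hGi.aestronglyMeasurable.mul hGi.aestronglyMeasurable)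
      (Eventually.of_forall fun ε => ?_)
    have hi := inv_pos.2 (hgpos ε)
    rw [Real.norm_eq_abs, abs_of_pos (mul_pos hi hi)]
    exact mul_le_mul_of_nonneg_right (inv_bennett_g_le hnf hnr W ΔF ε) hi.le
  have hα2 : Integrable (fun ε => ((1 / nr) * (g ε)⁻¹) ^ 2) (fwdPathLaw ν₁ κR) := by
    simp_rw [hsq_form, mul_assoc]
    exact hinv2.const_mul _
  have hα2w : Integrable (fun ε => Real.exp (ΔF - W ε) * ((1 / nr) * (g ε)⁻¹) ^ 2) (fwdPathLaw ν₁ κR) := by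
    -- `e^{ΔF−W} g⁻¹ ≤ nf`, so the integrand is bounded by `nf (1/nr)² g⁻¹`
    refine ((hGi.const_mul (nf * (1 / nr) ^ 2))).mono'
      (((Real.measurable_exp.comp (measurable_const.sub h.measurable_W)).aestronglyMeasurable).mul
        hα2.aestronglyMeasurable) (Eventually.of_forall fun ε => ?_)
    have hi := inv_pos.2 (hgpos ε)
    have hexp := Real.exp_pos (ΔF - W ε)
    rw [Real.norm_eq_abs, abs_of_pos (mul_pos hexp (by positivity)), hsq_form]
    have hbd : Real.exp (ΔF - W ε) * (g ε)⁻¹ ≤ nf := by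
      rw [← div_eq_mul_inv, div_le_iff₀ (hgpos ε), hgdef]
      simp only
      have : Real.exp (ΔF - W ε) = nf * (Real.exp (ΔF - W ε) / nf) := by field_simp
      nlinarith [div_pos one_pos hnr, hnf]
    calc Real.exp (ΔF - W ε) * ((1 / nr) ^ 2 * (g ε)⁻¹ * (g ε)⁻¹)
        = (Real.exp (ΔF - W ε) * (g ε)⁻¹) * ((1 / nr) ^ 2 * (g ε)⁻¹) := by ring
      _ ≤ nf * ((1 / nr) ^ 2 * (g ε)⁻¹) := mul_le_mul_of_nonneg_right hbd (by positivity)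
      _ = nf * (1 / nr) ^ 2 * (g ε)⁻¹ := by ring
  have hAne : ∫ ε, (1 / nr) * (g ε)⁻¹ ∂(fwdPathLaw ν₁ κR) ≠ 0 := by
    rw [hA]
    exact mul_ne_zero (by positivity) hG.ne'
  rw [h.bennett_substitution h0 h1 hΔF hnf hnr hAne hα2 hα2w]
  -- `E_R[g α⋆²] = (1/nr)² G` and `E_R[α⋆] = (1/nr) G`
  have hnum : ∫ ε, g ε * ((1 / nr) * (g ε)⁻¹) ^ 2 ∂(fwdPathLaw ν₁ κR) =
      (1 / nr) ^ 2 * ∫ ε, (g ε)⁻¹ ∂(fwdPathLaw ν₁ κR) := by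
    rw [← integral_const_mul]
    refine integral_congr_ae (Eventually.of_forall fun ε => ?_)
    have hg0 : g ε ≠ 0 := (hgpos ε).ne'
    simp only
    field_simp
  rw [hnum, hA]
  have hnr0 : nr ≠ 0 := hnr.ne'
  set G := ∫ ε, (g ε)⁻¹ ∂(fwdPathLaw ν₁ κR) with hGdef'
  have hG0 : G ≠ 0 := hG.ne'
  field_simp

end CrooksPair

end Summit.Ventures.LatticeQCDFlow.Exactness.GeneralNCMC
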